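import Mathlib
import HarnessLib
import Summits.ResolutionOfSingularities.ResolutionOfSingularities.Theorems.HomologicalConductorPersistenceKC3FrobeniusOrderDefs

/-!
# K-C3, object K4d (basis): `W₀ = k[a,b,c]^{μ₆(1,2,3)}` is FREE of rank 6 over `P₀ = k[a⁶, b³, c²]`
# on the box monomials `1, a⁴b, a²b², a³c, abc, a⁵b²c`; the Frobenius form `τ`

Route `ResolutionOfSingularities/HomologicalConductor`, chain W4.4b, crux `Persistence`
(stmt-ResolutionOfSingularities-16484), KILL CANDIDATE K-C3 (res-L1-w44b-plan-1 ASSIGN v1.9 / K5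
AMENDMENT 2026-08-27T12:34:43Z (B): «037 TAKES K4d» on the W-model of record).
[OURS · L1 w44b · res-D-pv-037 gen 9; AI-written and AI-reviewed only (weaker than expert review);
NOT a statement of the manuscript under study.]

Continues `…PersistenceKC3FrobeniusOrderDefs.lean` (`kc3W`, `kc3θ`, the `P₀`-algebra structure,
the closed form `mem_kc3W_iff`):

* `box : Fin 6 → (Fin 3 →₀ ℕ)` — the exponents `(0,0,0), (4,1,0), (2,2,0), (3,0,1), (1,1,1), (5,2,1)`,
  `boxMonomial k i : ↥W₀`; `rem` / `quo` — componentwise remainder / quotient of an exponent modulo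
  `(6,3,2)`, `rem_add_sc_quo : rem d + sc (quo d) = d`, `rem_eq_box` (a lattice exponent has its
  remainder among the six boxes, index `boxIdx d = (j % 3) + 3 (l % 2)`), `monomial_eq_smul_boxMonomial`;
* **`kc3Basis k : Module.Basis (Fin 6) ↥P₀ ↥W₀`** (`P₀ = kc3P k = k[a⁶,b³,c²] ⊆ W₀`; `kc3Basis_apply : kc3Basis k i = boxMonomial k i`,
  `kc3Basis_repr_monomial : repr (a^i b^j c^l) = single (boxIdx) (A^{i/6} B^{j/3} C^{l/2})`) — from the
  bijectivity of `kc3Coord : f ↦ Σᵢ fᵢ • mᵢ` (`kc3Coord_injective/surjective`: coefficient extraction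
  along `box n + sc q`, and the box decomposition of every lattice monomial);
* `kc3BasisDual k := (kc3Basis k).reindex Fin.revPerm` (`a⁵b²c, abc, a³c, a²b², a⁴b, 1`);
* **`kc3τ k : ↥W₀ →ₗ[↥P₀] ↥P₀ := (kc3Basis k).coord 5`** — the `P₀`-coefficient of `a⁵b²c`
  (res-D-pv-058 U15's Frobenius form), `kc3τ_monomial`;
* `kc3θEquiv k : MvPolynomial (Fin 3) k ≃ₐ[k] ↥P₀` (`A ↦ a⁶, B ↦ b³, C ↦ c²`) — run certificates upstairs
  in `k[A,B,C]` and transport.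
-/

noncomputable section

-- single-problem summit: the doubled namespace component `ResolutionOfSingularities` is forced
set_option linter.dupNamespace false

open MvPolynomial

universe u

namespace Summit.ResolutionOfSingularities.ResolutionOfSingularities.Theorems.HomologicalConductor.KC3FrobeniusOrder

open Summit.ResolutionOfSingularities.ResolutionOfSingularities.Theorems.HomologicalConductor.KC3Witness (e e_apply_zero e_apply_one e_apply_two e_add e_zero)

variable {k : Type u} [Field k]

/-! ## The box monomials and the remainder decomposition -/

/-- The six box exponents `(0,0,0), (4,1,0), (2,2,0), (3,0,1), (1,1,1), (5,2,1)` — indexed so that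
`box n` has `(j % 3, l % 2) = (n % 3, n / 3)`. [OURS · L1 w44b] -/
def box : Fin 6 → (Fin 3 →₀ ℕ) := ![e 0 0 0, e 4 1 0, e 2 2 0, e 3 0 1, e 1 1 1, e 5 2 1]

/-- The box exponents lie on the lattice. [OURS · bookkeeping] -/
theorem wt_box_dvd (n : Fin 6) : 6 ∣ wt (box n) := by
  fin_cases n <;> simp [box, wt, e]

/-- Componentwise remainder of an exponent modulo `(6, 3, 2)`. [OURS · bookkeeping] -/
def rem (d : Fin 3 →₀ ℕ) : Fin 3 →₀ ℕ := e (d 0 % 6) (d 1 % 3) (d 2 % 2)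

/-- Componentwise quotient of an exponent by `(6, 3, 2)`. [OURS · bookkeeping] -/
def quo (d : Fin 3 →₀ ℕ) : Fin 3 →₀ ℕ := e (d 0 / 6) (d 1 / 3) (d 2 / 2)

/-- `d = rem d + sc (quo d)`. [OURS · bookkeeping] -/
theorem rem_add_sc_quo (d : Fin 3 →₀ ℕ) : rem d + sc (quo d) = d := by
  ext i; fin_cases i <;> simp [rem, quo, sc, e] <;> omega

/-- The box index of a lattice exponent: `(j % 3) + 3 (l % 2)`. [OURS · bookkeeping] -/
def boxIdx (d : Fin 3 →₀ ℕ) : Fin 6 :=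
  ⟨d 1 % 3 + 3 * (d 2 % 2), by omega⟩

/-- On the lattice the remainder is the box monomial of index `boxIdx d`. [OURS · L1 w44b] -/
theorem rem_eq_box {d : Fin 3 →₀ ℕ} (hd : 6 ∣ wt d) : rem d = box (boxIdx d) := by
  simp only [wt] at hd
  obtain ⟨n, hn⟩ : ∃ n : Fin 6, boxIdx d = n := ⟨_, rfl⟩
  have hv : d 1 % 3 + 3 * (d 2 % 2) = (n : ℕ) := by
    have := congrArg Fin.val hn; simpa [boxIdx] using this
  rw [hn]
  fin_cases n <;> (ext i; fin_cases i <;> simp [rem, box, e] at hv ⊢ <;> omega)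

/-- `boxIdx (box n + sc q) = n`. [OURS · bookkeeping] -/
theorem boxIdx_box_add_sc (n : Fin 6) (q : Fin 3 →₀ ℕ) : boxIdx (box n + sc q) = n := by
  apply Fin.ext
  fin_cases n <;> simp [boxIdx, box, e]

/-- `quo (box n + sc q) = q`. [OURS · bookkeeping] -/
theorem quo_box_add_sc (n : Fin 6) (q : Fin 3 →₀ ℕ) : quo (box n + sc q) = q := by
  ext i; fin_cases n <;> fin_cases i <;> simp [quo, box, e] <;> omega

/-- `rem (box n + sc q) = box n`. [OURS · bookkeeping] -/
theorem rem_box_add_sc (n : Fin 6) (q : Fin 3 →₀ ℕ) : rem (box n + sc q) = box n := by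
  ext i; fin_cases n <;> fin_cases i <;> simp [rem, box, e]

/-- An exponent on the sublattice `6ℕ × 3ℕ × 2ℕ` is `sc` of its quotient. [OURS · bookkeeping] -/
theorem eq_sc_quo_of_dvd {d : Fin 3 →₀ ℕ} (h0 : 6 ∣ d 0) (h1 : 3 ∣ d 1) (h2 : 2 ∣ d 2) :
    d = sc (quo d) := by
  obtain ⟨u, hu⟩ := h0; obtain ⟨v, hv⟩ := h1; obtain ⟨w, hw⟩ := h2
  ext i; fin_cases i <;> simp [quo, sc, e, hu, hv, hw]

/-- `box n + sc q = box m + sc q'` forces `n = m` (and `q = q'`). [OURS · bookkeeping] -/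
theorem box_add_sc_injective {n m : Fin 6} {q q' : Fin 3 →₀ ℕ} (h : box n + sc q = box m + sc q') :
    n = m := by
  rw [← boxIdx_box_add_sc n q, h, boxIdx_box_add_sc]

variable (k) in
/-- The box monomials `m₀ … m₅ = 1, a⁴b, a²b², a³c, abc, a⁵b²c` as elements of `W₀`.
[OURS · L1 w44b] -/
def boxMonomial (n : Fin 6) : ↥(kc3W k) := ⟨monomial (box n) 1, monomial_mem_kc3W (wt_box_dvd n) 1⟩

/-- The underlying polynomial of a box monomial. [OURS · bookkeeping] -/
@[simp] theorem coe_boxMonomial (n : Fin 6) :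
    (boxMonomial k n : MvPolynomial (Fin 3) k) = monomial (box n) 1 := rfl

variable (k) in
/-- The scaled monomial `a^{6i} b^{3j} c^{2l}` (times `c`) as an element of `P₀`. [OURS · bookkeeping] -/
def scMonomial (q : Fin 3 →₀ ℕ) (c : k) : ↥(kc3P k) := ⟨monomial (sc q) c, monomial_sc_mem_kc3P q c⟩

/-- The underlying polynomial of a scaled monomial. [OURS · bookkeeping] -/
@[simp] theorem coe_scMonomial (q : Fin 3 →₀ ℕ) (c : k) :
    (scMonomial k q c : MvPolynomial (Fin 3) k) = monomial (sc q) c := rfl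

/-- `scMonomial 0 1 = 1`. [OURS · bookkeeping] -/
@[simp] theorem scMonomial_zero_one : scMonomial k 0 1 = 1 := by
  apply Subtype.ext
  rw [coe_scMonomial, show sc 0 = 0 by ext i; fin_cases i <;> simp [sc, e]]
  rfl

/-- A lattice monomial is `(its quotient part) • (its box monomial)`:
`a^i b^j c^l = (a^{6(i/6)} b^{3(j/3)} c^{2(l/2)}) · m_{boxIdx}`. [OURS · L1 w44b] -/
theorem monomial_eq_smul_boxMonomial {d : Fin 3 →₀ ℕ} (hd : 6 ∣ wt d) (c : k) :
    (⟨monomial d c, monomial_mem_kc3W hd c⟩ : ↥(kc3W k)) =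
      scMonomial k (quo d) c • boxMonomial k (boxIdx d) := by
  apply Subtype.ext
  rw [coe_smul_kc3P, coe_scMonomial, coe_boxMonomial, monomial_mul, mul_one, ← rem_eq_box hd,
    add_comm, rem_add_sc_quo]

/-! ## The basis -/

variable (k) in
/-- The coordinate map `(Fin 6 → P₀) → W₀`, `f ↦ Σᵢ fᵢ • mᵢ`. [OURS · L1 w44b] -/
def kc3Coord : (Fin 6 → ↥(kc3P k)) →ₗ[↥(kc3P k)] ↥(kc3W k) where
  toFun f := ∑ i, f i • boxMonomial k i
  map_add' f g := by
    change ∑ i, (f i + g i) • boxMonomial k i = _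
    rw [← Finset.sum_add_distrib]
    exact Finset.sum_congr rfl fun i _ => add_smul _ _ _
  map_smul' p f := by
    change ∑ i, (p * f i) • boxMonomial k i = p • ∑ i, f i • boxMonomial k i
    rw [Finset.smul_sum]
    exact Finset.sum_congr rfl fun i _ => mul_smul _ _ _

/-- Unfolding of the coordinate map. [OURS · bookkeeping] -/
theorem kc3Coord_apply (f : Fin 6 → ↥(kc3P k)) : kc3Coord k f = ∑ i, f i • boxMonomial k i := rfl

/-- The coefficient extraction behind linear independence: the `(box n + sc q)`-coefficient of
`Σᵢ fᵢ mᵢ` (`fᵢ ∈ P₀`) is the `(sc q)`-coefficient of `f n`. [OURS · L1 w44b] -/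
theorem coeff_box_add_sc_sum (f : Fin 6 → ↥(kc3P k)) (n : Fin 6) (q : Fin 3 →₀ ℕ) :
    coeff (box n + sc q) (∑ i, (f i : MvPolynomial (Fin 3) k) * monomial (box i) 1) =
      coeff (sc q) (f n : MvPolynomial (Fin 3) k) := by
  classical
  rw [coeff_sum]
  have : ∀ i, coeff (box n + sc q) ((f i : MvPolynomial (Fin 3) k) * monomial (box i) 1) =
      if i = n then coeff (sc q) (f n : MvPolynomial (Fin 3) k) else 0 := by
    intro i
    rw [coeff_mul_monomial', mul_one]
    by_cases hle : box i ≤ box n + sc q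
    · rw [if_pos hle]
      by_cases hin : i = n
      · subst hin
        rw [if_pos rfl, show box i + sc q - box i = sc q from add_tsub_cancel_left _ _]
      · rw [if_neg hin]
        by_contra hne
        apply hin
        have hdvd := dvd_of_mem_kc3P (f i).2 _ (mem_support_iff.mpr hne)
        have heq : box n + sc q - box i = sc (quo (box n + sc q - box i)) :=
          eq_sc_quo_of_dvd hdvd.1 hdvd.2.1 hdvd.2.2
        have : box i + sc (quo (box n + sc q - box i)) = box n + sc q := by
          rw [← heq, add_tsub_cancel_of_le hle]
        exact box_add_sc_injective this
    · rw [if_neg hle, if_neg]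
      rintro rfl
      exact hle le_self_add
  simp_rw [this, Finset.sum_ite_eq', Finset.mem_univ, if_true]

/-- The coordinate map `(Fin 6 → P₀) → W₀`, `f ↦ Σᵢ fᵢ • mᵢ`, is injective. [OURS · L1 w44b] -/
theorem kc3Coord_injective : Function.Injective (kc3Coord k) := by
  classical
  intro f g h
  rw [kc3Coord_apply, kc3Coord_apply] at h
  have h' : (∑ i, (f i : MvPolynomial (Fin 3) k) * monomial (box i) 1) =
      ∑ i, (g i : MvPolynomial (Fin 3) k) * monomial (box i) 1 := by
    have := congrArg (fun w : ↥(kc3W k) => (w : MvPolynomial (Fin 3) k)) h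
    simpa only [AddSubmonoidClass.coe_finsetSum, coe_smul_kc3P, coe_boxMonomial] using this
  funext n
  apply Subtype.ext
  ext d
  by_cases hd : 6 ∣ d 0 ∧ 3 ∣ d 1 ∧ 2 ∣ d 2
  · rw [eq_sc_quo_of_dvd hd.1 hd.2.1 hd.2.2, ← coeff_box_add_sc_sum f n, ← coeff_box_add_sc_sum g n,
      h']
  · rw [notMem_support_iff.mp (fun hm => hd (dvd_of_mem_kc3P (f n).2 d hm)),
      notMem_support_iff.mp (fun hm => hd (dvd_of_mem_kc3P (g n).2 d hm))]

/-- The coordinate map `(Fin 6 → P₀) → W₀` is surjective: `W₀ = ⊕ᵢ P₀ · mᵢ`. [OURS · L1 w44b] -/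
theorem kc3Coord_surjective : Function.Surjective (kc3Coord k) := by
  classical
  -- the image is a `P₀`-submodule containing every lattice monomial
  set Ψ := kc3Coord k
  intro w
  obtain ⟨p, hp⟩ := w
  have hmono : ∀ (d : Fin 3 →₀ ℕ) (hd : 6 ∣ wt d) (c : k),
      (⟨monomial d c, monomial_mem_kc3W hd c⟩ : ↥(kc3W k)) ∈ LinearMap.range Ψ := by
    intro d hd c
    rw [monomial_eq_smul_boxMonomial hd c]
    refine ⟨Pi.single (boxIdx d) (scMonomial k (quo d) c), ?_⟩
    rw [show Ψ = kc3Coord k from rfl, kc3Coord_apply, Finset.sum_eq_single (boxIdx d)]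
    · rw [Pi.single_eq_same]
    · intro i _ hi; rw [Pi.single_eq_of_ne hi, zero_smul]
    · intro h; exact absurd (Finset.mem_univ _) h
  suffices h : (⟨p, hp⟩ : ↥(kc3W k)) ∈ LinearMap.range Ψ by
    obtain ⟨f, hf⟩ := h; exact ⟨f, hf⟩
  have hL := mem_kc3W_iff.mp hp
  have : (⟨p, hp⟩ : ↥(kc3W k)) =
      ∑ d ∈ p.support.attach, (⟨monomial d.1 (coeff d.1 p), monomial_mem_kc3W (hL d.1 d.2) _⟩ :
        ↥(kc3W k)) := by
    apply Subtype.ext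
    rw [AddSubmonoidClass.coe_finsetSum]
    change p = ∑ d ∈ p.support.attach, monomial d.1 (coeff d.1 p)
    rw [Finset.sum_attach p.support (fun d => monomial d (coeff d p))]
    exact as_sum p
  rw [this]
  exact Submodule.sum_mem _ fun d _ => hmono d.1 (hL d.1 d.2) _

variable (k) in
/-- **`W₀` is free of rank 6 over `P₀ = k[a⁶,b³,c²]` on the box monomials**
`1, a⁴b, a²b², a³c, abc, a⁵b²c`. [OURS · L1 w44b; res-D-pv-058 U15 "checked by hand", here by the
kernel] -/
def kc3Basis : Module.Basis (Fin 6) ↥(kc3P k) ↥(kc3W k) :=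
  (Pi.basisFun ↥(kc3P k) (Fin 6)).map
    (LinearEquiv.ofBijective (kc3Coord k) ⟨kc3Coord_injective, kc3Coord_surjective⟩)

/-- The basis vectors are the box monomials. [OURS · L1 w44b] -/
@[simp] theorem kc3Basis_apply (n : Fin 6) : kc3Basis k n = boxMonomial k n := by
  classical
  rw [kc3Basis, Module.Basis.map_apply, Pi.basisFun_apply, LinearEquiv.ofBijective_apply,
    kc3Coord_apply, Finset.sum_eq_single n]
  · rw [Pi.single_eq_same, one_smul]
  · intro i _ hi; rw [Pi.single_eq_of_ne hi, zero_smul]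
  · intro h; exact absurd (Finset.mem_univ _) h

/-- Coordinates of a lattice monomial:
`repr (a^i b^j c^l) = single (boxIdx) (a^{6(i/6)} b^{3(j/3)} c^{2(l/2)})`. [OURS · L1 w44b] -/
theorem kc3Basis_repr_monomial {d : Fin 3 →₀ ℕ} (hd : 6 ∣ wt d) (c : k) :
    (kc3Basis k).repr ⟨monomial d c, monomial_mem_kc3W hd c⟩ =
      Finsupp.single (boxIdx d) (scMonomial k (quo d) c) := by
  rw [monomial_eq_smul_boxMonomial hd c, ← kc3Basis_apply, LinearEquiv.map_smul,
    (kc3Basis k).repr_self, Finsupp.smul_single, smul_eq_mul, mul_one]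

variable (k) in
/-- The dual basis `a⁵b²c, abc, a³c, a²b², a⁴b, 1` (the box basis reversed). [OURS · L1 w44b] -/
def kc3BasisDual : Module.Basis (Fin 6) ↥(kc3P k) ↥(kc3W k) :=
  (kc3Basis k).reindex Fin.revPerm

/-- `m∨ₙ = m_{5-n}`. [OURS · L1 w44b] -/
@[simp] theorem kc3BasisDual_apply (n : Fin 6) : kc3BasisDual k n = boxMonomial k (Fin.rev n) := by
  rw [kc3BasisDual, Module.Basis.reindex_apply, Fin.revPerm_symm, Fin.revPerm_apply, kc3Basis_apply]

variable (k) in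
/-- **The Frobenius form `τ : W₀ → P₀`** — the `P₀`-coordinate along `a⁵b²c` (res-D-pv-058 U15).
[OURS · L1 w44b] -/
def kc3τ : ↥(kc3W k) →ₗ[↥(kc3P k)] ↥(kc3P k) := (kc3Basis k).coord 5

/-- `τ` on a lattice monomial: the quotient part if the box index is `5` (`a⁵b²c`), else `0`.
[OURS · L1 w44b] -/
theorem kc3τ_monomial {d : Fin 3 →₀ ℕ} (hd : 6 ∣ wt d) (c : k) :
    kc3τ k ⟨monomial d c, monomial_mem_kc3W hd c⟩ =
      if boxIdx d = 5 then scMonomial k (quo d) c else 0 := by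
  rw [kc3τ, Module.Basis.coord_apply, kc3Basis_repr_monomial hd c, Finsupp.single_apply]

/-! ## `k[A,B,C] ≃ P₀` (for computations upstairs) -/

/-- The range of `θ : k[A,B,C] → k[a,b,c]` (`A ↦ a⁶, B ↦ b³, C ↦ c²`) is `P₀`. [OURS · L1 w44b] -/
theorem kc3θ_range : (kc3θ k).range = kc3P k := by
  apply le_antisymm
  · rintro _ ⟨p, rfl⟩
    exact kc3θ_mem_kc3P p
  · rw [kc3P]
    refine Algebra.adjoin_le ?_
    rintro x hx
    simp only [Set.mem_insert_iff, Set.mem_singleton_iff] at hx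
    rcases hx with rfl | rfl | rfl
    · exact ⟨X 0, by simp [kc3θ]⟩
    · exact ⟨X 1, by simp [kc3θ]⟩
    · exact ⟨X 2, by simp [kc3θ]⟩

variable (k) in
/-- **`k[A,B,C] ≃ₐ[k] P₀`** along `θ` (`A ↦ a⁶, B ↦ b³, C ↦ c²`): the base ring of the Frobenius order
IS a polynomial ring in three variables; use this to run certificates (e.g. K4e) in `MvPolynomial (Fin 3) k`
and transport them to `↥(kc3P k)`. [OURS · L1 w44b] -/
def kc3θEquiv : MvPolynomial (Fin 3) k ≃ₐ[k] ↥(kc3P k) :=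
  (AlgEquiv.ofInjective (kc3θ k) kc3θ_injective).trans (Subalgebra.equivOfEq _ _ kc3θ_range)

/-- The underlying polynomial of `kc3θEquiv p` is `θ p`. [OURS · L1 w44b] -/
@[simp] theorem coe_kc3θEquiv (p : MvPolynomial (Fin 3) k) :
    (kc3θEquiv k p : MvPolynomial (Fin 3) k) = kc3θ k p := rfl

/-- `kc3θEquiv` on monomials: `A^i B^j C^l ↦ a^{6i} b^{3j} c^{2l}`. [OURS · L1 w44b] -/
theorem kc3θEquiv_monomial (q : Fin 3 →₀ ℕ) (c : k) : kc3θEquiv k (monomial q c) = scMonomial k q c :=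
  Subtype.ext (by rw [coe_kc3θEquiv, kc3θ_monomial, coe_scMonomial])

end Summit.ResolutionOfSingularities.ResolutionOfSingularities.Theorems.HomologicalConductor.KC3FrobeniusOrder

end
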